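import Mathlib.Analysis.SpecialFunctions.Pow.Real
import Mathlib.Algebra.BigOperators.Ring.Finset
import HarnessLib

/-!
# K2R `RealisedQuasiStaticCellLaw`, line `floquet-bloch`, stub `stub_lowSectorWeakNear`: the isotropy lower bound `μ` of the
# co-moving exponents (helper; `--supports stmt-AnomalousDissipation-20446`)

Summits-side helper file (pure real algebra over slot sums; no definitions, no named facts). The hypothesis `hiso` of
`comoving_transport_lower` (p586227) asks for `μ(z₁² + z₂²) ≤ Σ_j (X_{o,j}(rc_j z₁ + rs_j z₂)² + X_{i,j}(−rs_j z₁ + rc_j z₂)²)`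
with `X_{•,j} = Λ_j(d₀,jτ_j + σ_{•,j}g_j²(τ_j r))`. `iso_mu_lower` provides it with
`μ = Σ_jΛ_jd₀,jτ_j + r·C_s·(2G − D·Σ_js_j)` from: the rotations (`rc_j² + rs_j² = 1`), the coupling identity
`Λ_jτ_jg_j² = C_s s_j`, the weights `σ_{o,j} ≥ 2`, `σ_{i,j} ≥ 2ĉ_j² − D` (`outPlane_weight_ge_two`, `inPlane_floor_defect`), and
the ISOTROPY identity `Σ_j s_j((rc_jz₁ + rs_jz₂)² + ĉ_j²(−rs_jz₁ + rc_jz₂)²) = G(z₁² + z₂²)` (the cubature word: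
`isotropicWordGain_cubatureWord` through `slotGain_frame` and the frame bridge).
-/

set_option linter.dupNamespace false

namespace Summit.AnomalousDissipation.AnomalousDissipation.Theorems.SolenoidalFractalHomogenisation.RealisedQuasiStaticCellLaw

open Finset

/-- **Isotropy lower bound of the co-moving exponents** (`hiso` of `comoving_transport_lower`). -/
theorem iso_mu_lower {k₀ : ℕ} (Λ d0 τ σo σi g s c2 rc rs : Fin k₀ → ℝ) {r Cs G D : ℝ} (hr : 0 ≤ r) (hCs : 0 ≤ Cs)
    (hD : 0 ≤ D) (hrot : ∀ j, rc j ^ 2 + rs j ^ 2 = 1) (hTg : ∀ j, Λ j * τ j * g j ^ 2 = Cs * s j)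
    (hs0 : ∀ j, 0 ≤ s j) (hσo : ∀ j, 2 ≤ σo j) (hσi : ∀ j, 2 * c2 j - D ≤ σi j)
    (hG : ∀ z₁ z₂ : ℝ, ∑ j, s j * ((rc j * z₁ + rs j * z₂) ^ 2 + c2 j * (-rs j * z₁ + rc j * z₂) ^ 2) = G * (z₁ ^ 2 + z₂ ^ 2)) :
    ∀ z₁ z₂ : ℝ, (∑ j, Λ j * d0 j * τ j + r * Cs * (2 * G - D * ∑ j, s j)) * (z₁ ^ 2 + z₂ ^ 2) ≤
      ∑ j, ((Λ j * (d0 j * τ j + σo j * g j ^ 2 * (τ j * r))) * (rc j * z₁ + rs j * z₂) ^ 2 +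
        (Λ j * (d0 j * τ j + σi j * g j ^ 2 * (τ j * r))) * (-rs j * z₁ + rc j * z₂) ^ 2) := by
  intro z₁ z₂
  have hz : 0 ≤ z₁ ^ 2 + z₂ ^ 2 := by positivity
  -- per slot: `u² + v² = z₁² + z₂²`
  have huv : ∀ j, (rc j * z₁ + rs j * z₂) ^ 2 + (-rs j * z₁ + rc j * z₂) ^ 2 = z₁ ^ 2 + z₂ ^ 2 := by
    intro j
    have h := hrot j
    nlinarith [h]
  -- per slot lower bound
  have key : ∀ j, Λ j * d0 j * τ j * (z₁ ^ 2 + z₂ ^ 2) +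
      r * Cs * (2 * (s j * ((rc j * z₁ + rs j * z₂) ^ 2 + c2 j * (-rs j * z₁ + rc j * z₂) ^ 2)) -
        D * s j * (z₁ ^ 2 + z₂ ^ 2)) ≤
      (Λ j * (d0 j * τ j + σo j * g j ^ 2 * (τ j * r))) * (rc j * z₁ + rs j * z₂) ^ 2 +
        (Λ j * (d0 j * τ j + σi j * g j ^ 2 * (τ j * r))) * (-rs j * z₁ + rc j * z₂) ^ 2 := by
    intro j
    have hu : 0 ≤ (rc j * z₁ + rs j * z₂) ^ 2 := sq_nonneg _
    have hv : 0 ≤ (-rs j * z₁ + rc j * z₂) ^ 2 := sq_nonneg _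
    have hv' : (-rs j * z₁ + rc j * z₂) ^ 2 ≤ z₁ ^ 2 + z₂ ^ 2 := by linarith only [huv j, hu]
    -- rewrite the right-hand side with `Λτg² = Cs s`
    have e : (Λ j * (d0 j * τ j + σo j * g j ^ 2 * (τ j * r))) * (rc j * z₁ + rs j * z₂) ^ 2 +
        (Λ j * (d0 j * τ j + σi j * g j ^ 2 * (τ j * r))) * (-rs j * z₁ + rc j * z₂) ^ 2 =
        Λ j * d0 j * τ j * ((rc j * z₁ + rs j * z₂) ^ 2 + (-rs j * z₁ + rc j * z₂) ^ 2) +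
          r * (Λ j * τ j * g j ^ 2) * (σo j * (rc j * z₁ + rs j * z₂) ^ 2 + σi j * (-rs j * z₁ + rc j * z₂) ^ 2) := by
      ring
    rw [e, huv j, hTg j]
    have hrs : 0 ≤ r * (Cs * s j) := mul_nonneg hr (mul_nonneg hCs (hs0 j))
    have h1 : 2 * (rc j * z₁ + rs j * z₂) ^ 2 + (2 * c2 j - D) * (-rs j * z₁ + rc j * z₂) ^ 2 ≤
        σo j * (rc j * z₁ + rs j * z₂) ^ 2 + σi j * (-rs j * z₁ + rc j * z₂) ^ 2 := by
      have a := mul_le_mul_of_nonneg_right (hσo j) hu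
      have b := mul_le_mul_of_nonneg_right (hσi j) hv
      linarith only [a, b]
    have h2 := mul_le_mul_of_nonneg_left h1 hrs
    have h3 : D * s j * (-rs j * z₁ + rc j * z₂) ^ 2 ≤ D * s j * (z₁ ^ 2 + z₂ ^ 2) :=
      mul_le_mul_of_nonneg_left hv' (mul_nonneg hD (hs0 j))
    have h4 := mul_le_mul_of_nonneg_left h3 (mul_nonneg hr hCs)
    linarith only [h2, h4]
  -- sum over the slots
  have hsum := Finset.sum_le_sum fun j (_ : j ∈ (univ : Finset (Fin k₀))) => key j
  have eL : ∑ j, (Λ j * d0 j * τ j * (z₁ ^ 2 + z₂ ^ 2) +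
      r * Cs * (2 * (s j * ((rc j * z₁ + rs j * z₂) ^ 2 + c2 j * (-rs j * z₁ + rc j * z₂) ^ 2)) -
        D * s j * (z₁ ^ 2 + z₂ ^ 2))) =
      (∑ j, Λ j * d0 j * τ j + r * Cs * (2 * G - D * ∑ j, s j)) * (z₁ ^ 2 + z₂ ^ 2) := by
    rw [sum_add_distrib, ← sum_mul, ← mul_sum, sum_sub_distrib, ← mul_sum, hG, ← sum_mul, ← mul_sum]
    ring
  rw [eL] at hsum
  exact hsum

end Summit.AnomalousDissipation.AnomalousDissipation.Theorems.SolenoidalFractalHomogenisation.RealisedQuasiStaticCellLaw
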